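import Mathlib
import Summits.Ventures.PercRepro2.TypedORootEdgeSplit
import Summits.Ventures.PercRepro2.TypedBRootEdgeSplit

/-!
# Root-edge monotonicity of the typed bases, I: the exact reductions at a mark of typed degree
`≤ 1` (blind cell PercRepro2, night-3 g18, 2026-08-27; NIGHT3-CERT.md §26.14 / §27)

The candidate (ROOT-MONO-o) of night-3 g17 — adding a NEW typed edge `f = {o, a₁}` of type `1`
(pinned closed and untyped in the instance) never decreases the typed count of the kernel `K₃` of
(HCOV), `N(F) ≤ N(F + f)`; (ROOT-MONO-b) the same at `f = {b, a₁}` — is typed in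
`TypedRootMono.lean`. This file proves, in the kernel, what the candidate reduces to at a mark of
small typed degree:

* `typedCount_eq_zero_of_o_isolated` — with every edge at `o` pinned closed and untyped the count
  vanishes (`K₃` has one `o`-factor in every term: `KB_killO` at `(false, false, false)`);
* `rootMonoO_deg_zero` — at an `o` of typed degree `0` both sides of (ROOT-MONO-o) vanish
  (`o` pendant at the root on the right, `typedCount_o_pendant_root`);
* `typedCount_insert_zero` — the new edge with type `0` is the instance without it;
* `rootMonoO_deg_one_iff` — at an `o` of typed degree `1` (one typed edge `e = {o, u}` of type
  `1`, the other edges at `o` pinned closed) the (ROOT-MONO-o) instance IS the open `(1, 2)` typed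
  base: `N(F) ≤ N(F + f) ↔ 0 ≤ N(F + f, τ[f := 2])` (g17's split `typedCount_o_root_edge_split`);
* `rootMonoB_deg_one_iff` — the `b`-twin (`typedCount_b_root_edge_split`).

Own work; standard axioms.
-/

namespace Summit.Ventures.PercRepro2

namespace CovForm

namespace TypedRed

open OneTyped

section Main

open Classical

variable {V : Type*} {E : Type*} [Fintype E] [DecidableEq E] {R : Type*} [Field R]
  [LinearOrder R] [IsStrictOrderedRing R]

variable (ends : E → Sym2 V) (o a₁ a₂ a₃ b : V)

omit [LinearOrder R] [IsStrictOrderedRing R] in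
/-- The count of the zero kernel vanishes. -/
lemma typedCount_kernel_zero_rm (F : Finset E) (z : Config E) (τ : E → ℕ) :
    typedCount F z τ (fun _ _ _ => (0 : R)) = 0 := by
  unfold typedCount
  simp

omit [LinearOrder R] [IsStrictOrderedRing R] in
/-- **`o` isolated kills the count**: if every edge at `o` is pinned closed and untyped (witnessed
through an edge `f = {o, a₁}` off `F`, closed in `z`), the typed count of `K₃` vanishes — every
term of `K₃` carries one `o`-factor. -/
theorem typedCount_eq_zero_of_o_isolated {f : E} (hf : ends f = s(o, a₁)) (ho1 : o ≠ a₁)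
    (ho2 : o ≠ a₂) (ho3 : o ≠ a₃) (hob : o ≠ b) (F : Finset E) (hfF : f ∉ F) (z : Config E)
    (hzf : z f = false) (τ : E → ℕ)
    (hcl : ∀ e', e' ≠ f → o ∈ ends e' → e' ∉ F ∧ z e' = false) :
    typedCount F z τ (K3 ends o a₁ a₂ a₃ b : Config E → Config E → Config E → R) = 0 := by
  rw [← typedCount_kernel_zero_rm (R := R) F z τ]
  refine typedCount_congr_K_on F z τ fun x y w hxyw _ => ?_
  have hclx : ∀ (x : Config E), (∀ e, e ∉ F → x e = z e) →
      ∀ e', e' ≠ f → o ∈ ends e' → x e' = false := by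
    intro x hx e' he' ho
    obtain ⟨hF, hz⟩ := hcl e' he' ho
    rw [hx e' hF]
    exact hz
  have hxf : ∀ (x : Config E), (∀ e, e ∉ F → x e = z e) → Function.update x f false = x := by
    intro x hx
    have h : x f = false := (hx f hfF).trans hzf
    rw [← h]
    exact Function.update_eq_self f x
  have hx := fun e he => (hxyw e he).1
  have hy := fun e he => (hxyw e he).2.1
  have hw := fun e he => (hxyw e he).2.2
  rw [K3_eq_KB, ← hxf x hx, ← hxf y hy, ← hxf w hw,
    st_update_closed_o ends o a₁ a₂ a₃ b hf ho1 ho1 ho2 ho3 hob (hclx x hx),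
    st_update_closed_o ends o a₁ a₂ a₃ b hf ho1 ho1 ho2 ho3 hob (hclx y hy),
    st_update_closed_o ends o a₁ a₂ a₃ b hf ho1 ho1 ho2 ho3 hob (hclx w hw)]
  have h0 := KB_killO false false false (st ends o a₁ a₂ a₃ b (Function.update x f true))
    (st ends o a₁ a₂ a₃ b (Function.update y f true)) (st ends o a₁ a₂ a₃ b (Function.update w f true))
  simp only [cond_false, Bool.false_eq_true, if_false, add_zero] at h0
  rw [h0]
  simp

/-- **(ROOT-MONO-o) at typed degree `0`**: both sides vanish (`o` isolated on the left, `o` pendant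
at the root on the right, `typedCount_o_pendant_root`). -/
theorem rootMonoO_deg_zero {f : E} (hf : ends f = s(o, a₁)) (ho1 : o ≠ a₁) (ho2 : o ≠ a₂)
    (ho3 : o ≠ a₃) (hob : o ≠ b) (F : Finset E) (hfF : f ∉ F) (z : Config E) (hzf : z f = false)
    (τ : E → ℕ) (hcl : ∀ e', e' ≠ f → o ∈ ends e' → e' ∉ F ∧ z e' = false) :
    typedCount F z τ (K3 ends o a₁ a₂ a₃ b : Config E → Config E → Config E → R) ≤
      typedCount (insert f F) z (Function.update τ f 1) (K3 ends o a₁ a₂ a₃ b) := by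
  rw [typedCount_eq_zero_of_o_isolated ends o a₁ a₂ a₃ b hf ho1 ho2 ho3 hob F hfF z hzf τ hcl]
  rw [typedCount_o_pendant_root ends o a₁ a₂ a₃ b hf ho1 ho2 ho3 hob (insert f F)
    (Finset.mem_insert_self f F) z (Function.update τ f 1) (by simp) ?_]
  intro e' he' ho
  obtain ⟨hF, hz⟩ := hcl e' he' ho
  exact ⟨fun h => (Finset.mem_insert.1 h).elim he' hF, hz⟩

omit [LinearOrder R] [IsStrictOrderedRing R] in
/-- The count with the new edge `f` of type `0` is the count without `f`. -/
lemma typedCount_insert_zero (F : Finset E) (z : Config E) (τ : E → ℕ) {f : E} (hfF : f ∉ F)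
    (hzf : z f = false) (K : Config E → Config E → Config E → R) :
    typedCount (insert f F) z (Function.update τ f 0) K = typedCount F z τ K := by
  rw [typedCount_type_zero (insert f F) f (Finset.mem_insert_self f F) z _
    (Function.update_self _ _ _), Finset.erase_insert hfF]
  have hz : Function.update z f false = z := by
    rw [← hzf]; exact Function.update_eq_self f z
  rw [hz]
  exact typedCount_congr_τ F z (fun e he => Function.update_of_ne (fun h => hfF (by subst h; exact he)) _ _) K

/-- **(ROOT-MONO-o) at typed degree `1` IS the `(1, 2)` typed base**: with `e = {o, u}` of type `1`
the only typed edge at `o` (the others pinned closed), `f = {o, a₁}` new,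
`N(F) ≤ N(F + f) ↔ 0 ≤ N(F + f, τ[f := 2])`. -/
theorem rootMonoO_deg_one_iff {e f : E} (hf : ends f = s(o, a₁)) (hef : e ≠ f) (ho1 : o ≠ a₁)
    (ho2 : o ≠ a₂) (ho3 : o ≠ a₃) (hob : o ≠ b) (F : Finset E) (heF : e ∈ F) (hfF : f ∉ F)
    (z : Config E) (hzf : z f = false) (τ : E → ℕ) (hτe : τ e = 1)
    (hcl : ∀ e', e' ≠ e → e' ≠ f → o ∈ ends e' → e' ∉ F ∧ z e' = false) :
    typedCount F z τ (K3 ends o a₁ a₂ a₃ b : Config E → Config E → Config E → R) ≤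
        typedCount (insert f F) z (Function.update τ f 1) (K3 ends o a₁ a₂ a₃ b) ↔
      0 ≤ typedCount (insert f F) z (Function.update τ f 2)
        (K3 ends o a₁ a₂ a₃ b : Config E → Config E → Config E → R) := by
  have hcl' : ∀ e', e' ≠ e → e' ≠ f → o ∈ ends e' → e' ∉ insert f F ∧ z e' = false := by
    intro e' h1 h2 ho
    obtain ⟨hF, hz⟩ := hcl e' h1 h2 ho
    exact ⟨fun h => (Finset.mem_insert.1 h).elim h2 hF, hz⟩
  rw [typedCount_o_root_edge_split (R := R) ends o a₁ a₂ a₃ b hf hef ho1 ho2 ho3 hob (insert f F)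
    (Finset.mem_insert_of_mem heF) (Finset.mem_insert_self f F) z τ hτe hcl',
    typedCount_insert_zero F z τ hfF hzf]
  constructor
  · intro h; linarith
  · intro h; linarith

/-- **(ROOT-MONO-b) at typed degree `1` IS the `(1, 2)` typed base at `b`.** -/
theorem rootMonoB_deg_one_iff {e f : E} (hf : ends f = s(b, a₁)) (hef : e ≠ f) (hbo : b ≠ o)
    (hb1 : b ≠ a₁) (hb2 : b ≠ a₂) (hb3 : b ≠ a₃) (F : Finset E) (heF : e ∈ F) (hfF : f ∉ F)
    (z : Config E) (hzf : z f = false) (τ : E → ℕ) (hτe : τ e = 1)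
    (hcl : ∀ e', e' ≠ e → e' ≠ f → b ∈ ends e' → e' ∉ F ∧ z e' = false) :
    typedCount F z τ (K3 ends o a₁ a₂ a₃ b : Config E → Config E → Config E → R) ≤
        typedCount (insert f F) z (Function.update τ f 1) (K3 ends o a₁ a₂ a₃ b) ↔
      0 ≤ typedCount (insert f F) z (Function.update τ f 2)
        (K3 ends o a₁ a₂ a₃ b : Config E → Config E → Config E → R) := by
  have hcl' : ∀ e', e' ≠ e → e' ≠ f → b ∈ ends e' → e' ∉ insert f F ∧ z e' = false := by
    intro e' h1 h2 hb
    obtain ⟨hF, hz⟩ := hcl e' h1 h2 hb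
    exact ⟨fun h => (Finset.mem_insert.1 h).elim h2 hF, hz⟩
  rw [typedCount_b_root_edge_split (R := R) ends o a₁ a₂ a₃ b hf hef hbo hb1 hb2 hb3 (insert f F)
    (Finset.mem_insert_of_mem heF) (Finset.mem_insert_self f F) z τ hτe hcl',
    typedCount_insert_zero F z τ hfF hzf]
  constructor
  · intro h; linarith
  · intro h; linarith

end Main

end TypedRed

end CovForm

end Summit.Ventures.PercRepro2
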